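import Summits.QuantumFields.BalabanUV.T4Continuum.Support.NE7BorderedHessianOnSlice
import Summits.QuantumFields.BalabanUV.T4Continuum.Support.NE7MinActHessianUniform
import Summits.QuantumFields.BalabanUV.T4Continuum.Support.NE7MultiplierStrippedIdentity
import Summits.QuantumFields.BalabanUV.T4Continuum.Support.NE3ResidualSliceRep
import HarnessLib

/-!
# NE7EffectiveFormLowerBoundSocketUniform — H11 (`NE7EffectiveFormLowerBoundSocket`) RE-ISSUED WITH A LEVEL-UNIFORM DATUM RADIUS: `∀ N ∃ δV ∀ j` (lineage `b2b-balaban-t4-ne7-p1`, gen 119,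
# file U3 of the uniform (G′) chain)

Cell `pub-balaban`, rung (B)+1 sub-cell t4, CRUX PROVER NE7 #1 (OWNER of row NE7), generation 119.
WHY.  H11's two theorems (the bordered Hessian attained on the frame-free slice; (G′) from the local stripped multiplier letter) inherit `∀ N ∀ j ∃ δV` from gen 115's bordered Hessian and
multiplier identity.  Both inputs now exist with `∀ N ∃ δV ∀ j` (✓ U1 `NE7MinActHessianUniform.minAct_hessian_hessForm_allData_uniform`, row NE7b's ✓
`NE7MinActC2AllDataUniform.multiplier_eq_fderiv_minAct_allData_uniform`); ✓ H10 `multiplier_eq_stripped_allData` was uniform already.  THIS FILE is H11's proof verbatim on those inputs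
with the quantifiers reordered; U4 carries it to (G′).
WHAT ([folklore]; 0 def, 0 sorry; `d = 4`): **`bordered_hessian_attained_on_slice_frameFree_uniform`**, **`effectiveForm_lower_bound_of_localLetter_uniform`**.
HONEST FRAMING (page 1): composition of landed kernel theorems about OUR minimisers; nothing of Bałaban's asserted; NOT (G′) (U4), NOT NE7 as a spine node; spine 0∕9; finite T⁴ rung (B)+1
— NOT infinite volume, NOT mass gap, NOT BetaPertH, NOT Clay.
-/

set_option autoImplicit false

open scoped BigOperators Matrix Matrix.Norms.L2Operator Topology
open NormedSpace Finset Set Filter Metric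

namespace Summit.QuantumFields.BalabanUV.T4Continuum.NE7EffectiveFormLowerBoundSocketUniform

open Literature.MathematicalPhysics.QuantumFieldTheory.Balaban1983to89
open B7Prop1Explicit B7Prop2Explicit MatrixLog UnitaryModel
open T4AveragingDeficitWall (IsUnitaryCfg IsSkewDir SmallField Ad curl curlAt curlSq dirSq fineAction)
open T4AveragingDeficitWallBoundary (IsPeriodicCfg periodBox)
open AveragingDeficitTorusChart (TDir chart chartDir resDir)
open AveragingDeficitTwoLevelPrep (twoLevelSmall skewSub skewPR)
open AveragingDeficitMultiLevelPrep (cavgIter tower levelQ levelQ' LevelSmall natCast_tower_succ)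
open AveragingDeficitMultiLevelBridge (cavgIter_eq_avgIter)
open MatrixNorms (nhsNormSq)
open MinimalActionLevels (perWin stepWt)
open MinimalActionSandwich (IsMinimiser minAct)
open MinimalActionRate (sfClass)
open NE3HessForm (hess)
open NE7RadIterUniform (radD radD_nonneg levelSmall_of_class_radius)
open NE7StraightTowerCurlEnergy (eC mC)
open NE7FlatAverageCurlCommutation (isSkewDir_chartDir_id)
open BlockAveragePushDirGauge (gaugeDir)
open NE3QbarIterCovLiftPrep (cruxC)
open NE3RightInverseSolveLetters (thetaLoc)
open NE3SlicePoincareShape (SlicePoincare)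
open NE3FrameFreeSliceW (frameFreeBlockLandauW)
open NE3EnergyRateWSupOfSlicePoincare (tower_eq_mul_pow)
open NE7FrameFreeRightInverse (rightInvW0)
open NE7SliceRepHessianFloor (liftMassC liftCurlC sliceRep_args)
open NE7SliceRepLetters (exists_cornerGauge_sliceRep_letters)
open NE7MinActHessianUniform (minAct_hessian_hessForm_allData_uniform)
open NE7MinActC2AllDataUniform (multiplier_eq_fderiv_minAct_allData_uniform)
open NE7BorderedHessianGaugeDegenerate (borderedForm_add_gaugeDir fderiv_levelQ_chart_subtype_apply)
open NE7SecondVariationHess (second_variation)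

open NE3TangentCovariantTower (framePotW)
open NE3ResidualSliceRep (framePotW_sub)
open NE7FrameFreeRightInverse (framePotW_rightInvW0)
open NE7StrippedConstraintMap (strippedConstraint)
open NE7MultiplierStrippedIdentity (multiplier_eq_stripped_allData)
open NE7BorderedHessianOnSlice (classRadius_eq)

noncomputable section

variable {n : Type} [Fintype n] [DecidableEq n]

set_option maxHeartbeats 400000 in
/-- **THE BORDERED HESSIAN IS ATTAINED ON THE MULTI-LEVEL SLICE, WITH THE HESSIAN FLOOR** (`d = 4`, every `U(n)`, `L ≥ 2`).  `∃ ε₀ > 0 ∀ 0 < ε ≤ ε₀` obeying the k-free lines (`hεD`, `hεT` at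
`2ε`; `hεM`, `ε ≤ 1`, `cruxC·ε < 1`, `thetaLoc·ε ≤ 1∕2`, `43584·ε ≤ 1∕2`) `∀ N ≥ 1 ∀ j ∃ δ_V > 0 ∀ V₀` (unitary, `N`-periodic, `δ_V`-small) `∀ U♯` minimiser over `V₀` `∀ C_P ≥ 0` with row NE3's
`SlicePoincare L (j+1) U♯ T_♮(U♯) C_P` and `28·#pl·ε·(4C_P n) ≤ 1` `∀ θ > 0 ∀ v`: there is `X⋆ : skewSub (L·tower L N j)` with `levelQ′ X⋆ = v` and
(1) `D²(minAct∘chart_{V₀})(0)[v,v] = w·hess U♯ X̃⋆ X̃⋆ (perWin 4 (tower L N (j+1))) − Dm(0)[D²𝒢(0)[X⋆,X⋆]]` (`w = stepWt⁻ʲ⁻¹`),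
(2) `Σ_{P∈perWin N} nhs(curl V₀ ṽ P) ≤ ((1+θ) + 2K·(4C_P n))·hess U♯ X̃⋆ X̃⋆ (perWin) + 2K·ρ·dirSq ṽ (periodBox N)`,
(3) `(L⁻¹)^{2(j+1)}·dirSq X̃⋆ (periodBox (tower)) ≤ 2(4C_P n)·hess + 2ρ·dirSq ṽ (periodBox N)` (`ρ = 2liftMassC + 4C_P liftCurlC`, `K = (1+θ)·14·#pl·ε + (1+θ⁻¹)·36eC²ε²`).
[cite: Balaban1985Variational, Thm 1 p.279, (83) p.290; Balaban1985Averaging, (48) p.25; Balaban1985PropagatorsII, Thm 3.3 (3.46)] -/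
theorem bordered_hessian_attained_on_slice_frameFree_uniform [Nonempty n] {L : ℕ} [NeZero L] (hL : 2 ≤ L) :
    ∃ ε₀ : ℝ, 0 < ε₀ ∧ ∀ ε : ℝ, 0 < ε → ε ≤ ε₀ →
      4 * (2 * ε) * radD 4 L * (((L : ℝ) ^ 2)⁻¹) ^ 2 ≤ 1 → twoLevelSmall 4 L * (2 * (2 * ε) * ((L : ℝ) ^ 2)⁻¹) ≤ 1 →
      8 * (L : ℝ) * mC 4 L (Fintype.card n) * ε * ((L : ℝ) ^ 2)⁻¹ ≤ 1 → ε ≤ 1 → cruxC 4 L * ε < 1 → thetaLoc 4 L * ε ≤ 1 / 2 → 43584 * ε ≤ 1 / 2 →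
      ∀ (N : ℕ) [NeZero N], 1 ≤ N →
      ∃ δV : ℝ, 0 < δV ∧ ∀ j : ℕ,
        ∀ V₀ ∈ {V : Site 4 → Fin 4 → (Matrix n n ℂ)ˣ | IsUnitaryCfg V ∧ IsPeriodicCfg V (N : ℤ) ∧ SmallField V δV},
        ∀ Us : Site 4 → Fin 4 → (Matrix n n ℂ)ˣ, IsMinimiser 4 (sfClass 4 L N ε) L N (j + 1) V₀ Us →
        ∀ CP : ℝ, 0 ≤ CP → SlicePoincare L (j + 1) Us (frameFreeBlockLandauW (d := 4) (n := n) L N (j + 1) Us) CP (periodBox (N * L ^ (j + 1))) →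
        28 * (Fintype.card (T4AveragingDeficitWall.Plane 4) : ℝ) * ε * (4 * CP * Fintype.card n) ≤ 1 → ∀ θ : ℝ, 0 < θ →
        ∀ v : ↥(skewSub 4 n N), ∃ Xs : ↥(skewSub 4 n (L * tower L N j)),
          levelQ' L N j Us (Xs : TDir 4 n (L * tower L N j)) = v
          ∧ fderiv ℝ (fderiv ℝ (fun y : ↥(skewSub 4 n N) => minAct 4 (sfClass 4 L N ε) L N (j + 1) (chart (ContinuousLinearMap.id ℝ (Matrix n n ℂ)) N V₀ (y : TDir 4 n N)))) 0 v v
              = ((stepWt 4 L)⁻¹) ^ (j + 1) * hess Us (chartDir (ContinuousLinearMap.id ℝ (Matrix n n ℂ)) (L * tower L N j) (Xs : TDir 4 n (L * tower L N j)))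
                    (chartDir (ContinuousLinearMap.id ℝ (Matrix n n ℂ)) (L * tower L N j) (Xs : TDir 4 n (L * tower L N j))) (perWin 4 (tower L N (j + 1)))
                - fderiv ℝ (fun y : ↥(skewSub 4 n N) => minAct 4 (sfClass 4 L N ε) L N (j + 1) (chart (ContinuousLinearMap.id ℝ (Matrix n n ℂ)) N V₀ (y : TDir 4 n N))) 0
                    (fderiv ℝ (fderiv ℝ (fun Φ : ↥(skewSub 4 n (L * tower L N j)) =>
                      levelQ L N j Us (chart (ContinuousLinearMap.id ℝ (Matrix n n ℂ)) (L * tower L N j) Us (Φ : TDir 4 n (L * tower L N j))))) 0 Xs Xs)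
          ∧ ∑ P ∈ perWin 4 N, nhsNormSq (curl V₀ (chartDir (ContinuousLinearMap.id ℝ (Matrix n n ℂ)) N (v : TDir 4 n N)) P)
              ≤ ((1 + θ) + 2 * ((1 + θ) * (14 * (Fintype.card (T4AveragingDeficitWall.Plane 4) : ℝ) * ε) + (1 + θ⁻¹) * (36 * eC 4 L (Fintype.card n) ^ 2 * ε ^ 2))
                    * (4 * CP * Fintype.card n))
                  * hess Us (chartDir (ContinuousLinearMap.id ℝ (Matrix n n ℂ)) (L * tower L N j) (Xs : TDir 4 n (L * tower L N j)))
                      (chartDir (ContinuousLinearMap.id ℝ (Matrix n n ℂ)) (L * tower L N j) (Xs : TDir 4 n (L * tower L N j))) (perWin 4 (tower L N (j + 1)))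
                + 2 * ((1 + θ) * (14 * (Fintype.card (T4AveragingDeficitWall.Plane 4) : ℝ) * ε) + (1 + θ⁻¹) * (36 * eC 4 L (Fintype.card n) ^ 2 * ε ^ 2))
                    * ((2 * liftMassC 4 L + 4 * CP * liftCurlC 4 L) * dirSq (chartDir (ContinuousLinearMap.id ℝ (Matrix n n ℂ)) N (v : TDir 4 n N)) (periodBox N))
          ∧ ((L : ℝ)⁻¹) ^ (2 * (j + 1)) * dirSq (chartDir (ContinuousLinearMap.id ℝ (Matrix n n ℂ)) (L * tower L N j) (Xs : TDir 4 n (L * tower L N j))) (periodBox (tower L N (j + 1)))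
              ≤ 2 * (4 * CP * Fintype.card n)
                  * hess Us (chartDir (ContinuousLinearMap.id ℝ (Matrix n n ℂ)) (L * tower L N j) (Xs : TDir 4 n (L * tower L N j)))
                      (chartDir (ContinuousLinearMap.id ℝ (Matrix n n ℂ)) (L * tower L N j) (Xs : TDir 4 n (L * tower L N j))) (perWin 4 (tower L N (j + 1)))
                + 2 * ((2 * liftMassC 4 L + 4 * CP * liftCurlC 4 L) * dirSq (chartDir (ContinuousLinearMap.id ℝ (Matrix n n ℂ)) N (v : TDir 4 n N)) (periodBox N))
          ∧ framePotW L (j + 1) Us (chartDir (ContinuousLinearMap.id ℝ (Matrix n n ℂ)) (L * tower L N j) (Xs : TDir 4 n (L * tower L N j))) = (fun _ => 0) := by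
  have hL1 : 1 ≤ L := by omega
  obtain ⟨ε₁, hε₁, H1⟩ := minAct_hessian_hessForm_allData_uniform (n := n) hL
  obtain ⟨ε₂, hε₂, H2⟩ := multiplier_eq_fderiv_minAct_allData_uniform (n := n) hL
  refine ⟨min ε₁ ε₂, lt_min hε₁ hε₂, fun ε hε hεle hεD2 hεT2 hεM hε1 hcrux hθl2 hEl N _ hN => ?_⟩
  obtain ⟨δ₁, hδ₁, hA⟩ := H1 ε hε (hεle.trans (min_le_left _ _)) N hN
  obtain ⟨δ₂, hδ₂, hB⟩ := H2 ε hε (hεle.trans (min_le_right _ _)) N hN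
  refine ⟨min δ₁ δ₂, lt_min hδ₁ hδ₂, fun j V₀ hV₀ Us hUs CP hCP hSP habs θ hθ v => ?_⟩
  obtain ⟨hV₀u, hV₀P, hV₀δ⟩ := hV₀
  obtain ⟨-, hbord⟩ := hA j V₀ ⟨hV₀u, hV₀P, MinimalActionRate.SmallField.mono hV₀δ (min_le_left _ _)⟩
  obtain ⟨-, hleast⟩ := hbord Us hUs
  obtain ⟨-, hmult⟩ := hB j V₀ ⟨hV₀u, hV₀P, MinimalActionRate.SmallField.mono hV₀δ (min_le_right _ _)⟩ Us hUs
  -- class facts for the minimiser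
  obtain ⟨hUu, hUP0, hUx0⟩ := hUs.mem.1
  have hUP : IsPeriodicCfg Us ((tower L N (j + 1) : ℕ) : ℤ) := by rw [tower_eq_mul_pow]; exact hUP0
  have hUx : SmallField Us (ε * (((L : ℝ) ^ 2)⁻¹) ^ (j + 1)) := by rw [← classRadius_eq]; exact hUx0
  have hUsavg : cavgIter L (j + 1) Us = V₀ := by rw [cavgIter_eq_avgIter]; exact hUs.mem.2
  have hUP' : IsPeriodicCfg Us ((L * tower L N j : ℕ) : ℤ) := hUP
  have hUP'' : IsPeriodicCfg Us ((L : ℤ) * (tower L N j : ℕ)) := by rw [← natCast_tower_succ]; exact hUP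
  -- the ε-lines at `ε` from those at `2ε`
  have hε0 : 0 ≤ ε := hε.le
  have hq0 : 0 ≤ (((L : ℝ) ^ 2)⁻¹) := by positivity
  have hεD : 4 * ε * radD 4 L * (((L : ℝ) ^ 2)⁻¹) ^ 2 ≤ 1 := by
    have h1 : 4 * ε * radD 4 L * (((L : ℝ) ^ 2)⁻¹) ^ 2 ≤ 4 * (2 * ε) * radD 4 L * (((L : ℝ) ^ 2)⁻¹) ^ 2 := by
      have := radD_nonneg (d := 4) L
      have : 0 ≤ ε * radD 4 L * (((L : ℝ) ^ 2)⁻¹) ^ 2 := by positivity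
      nlinarith
    exact h1.trans hεD2
  have hεT : twoLevelSmall 4 L * (2 * ε * ((L : ℝ) ^ 2)⁻¹) ≤ 1 := by
    have ht : 0 ≤ twoLevelSmall 4 L := by unfold AveragingDeficitTwoLevelPrep.twoLevelSmall; positivity
    have h1 : twoLevelSmall 4 L * (2 * ε * ((L : ℝ) ^ 2)⁻¹) ≤ twoLevelSmall 4 L * (2 * (2 * ε) * ((L : ℝ) ^ 2)⁻¹) := by
      refine mul_le_mul_of_nonneg_left ?_ ht
      have : 0 ≤ ε * ((L : ℝ) ^ 2)⁻¹ := by positivity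
      nlinarith
    exact h1.trans hεT2
  -- the minimising lift
  obtain ⟨⟨X₀, hQ₀, hm⟩, -⟩ := hleast v
  -- G11 on the minimising lift
  obtain ⟨hx, hs, hcr, hE⟩ := sliceRep_args hL hε0 hεD hεT hcrux hEl j
  have hvs : IsSkewDir (chartDir (ContinuousLinearMap.id ℝ (Matrix n n ℂ)) N ((levelQ' L N j Us (X₀ : TDir 4 n (L * tower L N j)) : ↥(skewSub 4 n N)) : TDir 4 n N)) :=
    isSkewDir_chartDir_id (levelQ' L N j Us (X₀ : TDir 4 n (L * tower L N j))).2
  obtain ⟨mu, hmus, hmuP, hmu0, hq, hmem, hfloor, hmass, -⟩ :=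
    exists_cornerGauge_sliceRep_letters hL hN hε0 hεD hεT hεM hε1 hθl2 j hUu hUP hUx hx hs hcr hE hCP hSP habs hθ X₀ hvs
  -- the class with room at `2ε` and the bordered invariance
  obtain ⟨hs2, -⟩ := levelSmall_of_class_radius (d := 4) hL (by positivity : (0 : ℝ) ≤ 2 * ε) hεD2 hεT2 j
  have hxx' : ε * (((L : ℝ) ^ 2)⁻¹) ^ (j + 1) < 2 * ε * (((L : ℝ) ^ 2)⁻¹) ^ (j + 1) := by
    have hL0 : (0 : ℝ) < L := by exact_mod_cast (show 0 < L by omega)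
    have : 0 < (((L : ℝ) ^ 2)⁻¹) ^ (j + 1) := by positivity
    nlinarith
  have hcrit : ∀ Z : ↥(skewSub 4 n (L * tower L N j)),
      ((stepWt 4 L)⁻¹) ^ (j + 1) * fderiv ℝ (fun Φ : ↥(skewSub 4 n (L * tower L N j)) =>
          fineAction (chart (ContinuousLinearMap.id ℝ (Matrix n n ℂ)) (L * tower L N j) Us (Φ : TDir 4 n (L * tower L N j))) (perWin 4 (N * L ^ (j + 1)))) 0 Z
        = (fderiv ℝ (fun y : ↥(skewSub 4 n N) => minAct 4 (sfClass 4 L N ε) L N (j + 1) (chart (ContinuousLinearMap.id ℝ (Matrix n n ℂ)) N V₀ (y : TDir 4 n N))) 0)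
          (fderiv ℝ (fun Φ : ↥(skewSub 4 n (L * tower L N j)) =>
            levelQ L N j Us (chart (ContinuousLinearMap.id ℝ (Matrix n n ℂ)) (L * tower L N j) Us (Φ : TDir 4 n (L * tower L N j)))) 0 Z) := by
    intro Z
    rw [fderiv_levelQ_chart_subtype_apply (d := 4) hL1 j hUu hUP'' hx hs hUx Z]
    exact hmult Z
  obtain ⟨-, hBinv⟩ := borderedForm_add_gaugeDir (d := 4) hL1 j hUu hUP' hx hxx' hs2 hUx hmus hmuP hmu0 (perWin 4 (N * L ^ (j + 1)))
    (((stepWt 4 L)⁻¹) ^ (j + 1))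
    (fderiv ℝ (fun y : ↥(skewSub 4 n N) => minAct 4 (sfClass 4 L N ε) L N (j + 1) (chart (ContinuousLinearMap.id ℝ (Matrix n n ℂ)) N V₀ (y : TDir 4 n N))) 0) hcrit X₀
  set Xs : ↥(skewSub 4 n (L * tower L N j)) := X₀ + skewPR (d := 4) (n := n) (L * tower L N j) (resDir (L * tower L N j) (gaugeDir Us mu)) with hXs
  refine ⟨Xs, by rw [hq, hQ₀], ?_, ?_, ?_, ?_⟩
  · -- the value on the slice representative
    have eW : perWin 4 (tower L N (j + 1)) = perWin 4 (N * L ^ (j + 1)) := by rw [tower_eq_mul_pow L N (j + 1)]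
    rw [eW, ← second_variation Us (perWin 4 (N * L ^ (j + 1))) Xs, hBinv, second_variation Us (perWin 4 (N * L ^ (j + 1))) X₀]
    exact hm
  · rw [hQ₀, hUsavg] at hfloor
    exact hfloor
  · rw [hQ₀] at hmass
    exact hmass
  · -- the slice representative is TOP-FRAME-FREE: `X̃s − R₀ṽ ∈ T_♮` (frame-free) and `R₀` is frame-free
    obtain ⟨-, -, -, hff, -⟩ := hmem
    funext z
    have hsub := framePotW_sub (d := 4) hL1 j hUu hx hs hUx
      (chartDir (ContinuousLinearMap.id ℝ (Matrix n n ℂ)) (L * tower L N j) (Xs : TDir 4 n (L * tower L N j)))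
      (rightInvW0 hL j hUu hx hs hUx N hcr hE hvs) z
    have hR := framePotW_rightInvW0 hL j hUu hx hs hUx N hcr hE hvs hUP (0 : Fin 4) z
    have h := hff z
    rw [hsub, hR, sub_zero] at h
    exact h


set_option maxHeartbeats 400000 in
/-- **(G′) MODULO THE LOCAL STRIPPED MULTIPLIER LETTER** (see the module docstring). [folklore] -/
theorem effectiveForm_lower_bound_of_localLetter_uniform [Nonempty n] {L : ℕ} [NeZero L] (hL : 2 ≤ L) :
    ∃ ε₀ : ℝ, 0 < ε₀ ∧ ∀ ε : ℝ, 0 < ε → ε ≤ ε₀ →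
      4 * (2 * ε) * radD 4 L * (((L : ℝ) ^ 2)⁻¹) ^ 2 ≤ 1 → twoLevelSmall 4 L * (2 * (2 * ε) * ((L : ℝ) ^ 2)⁻¹) ≤ 1 →
      8 * (L : ℝ) * mC 4 L (Fintype.card n) * ε * ((L : ℝ) ^ 2)⁻¹ ≤ 1 → ε ≤ 1 → cruxC 4 L * ε < 1 → thetaLoc 4 L * ε ≤ 1 / 2 → 43584 * ε ≤ 1 / 2 →
      B7Prop2Explicit.C0 4 * (3 * ε) ≤ 1 / 3 → 4 * (3 * ε) ≤ B7Prop2Explicit.c2' 4 L →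
      Real.exp (4 * (800 * (((4 : ℕ) : ℝ) + 1) ^ 2 * (((4 : ℕ) : ℝ) + 4)) * (3 * ε)) ≤ 3 / 2 →
      ∀ (N : ℕ) [NeZero N], 1 ≤ N →
      ∃ δV : ℝ, 0 < δV ∧ ∀ j : ℕ,
        ∀ V₀ ∈ {V : Site 4 → Fin 4 → (Matrix n n ℂ)ˣ | IsUnitaryCfg V ∧ IsPeriodicCfg V (N : ℤ) ∧ SmallField V δV},
        ∀ Us : Site 4 → Fin 4 → (Matrix n n ℂ)ˣ, IsMinimiser 4 (sfClass 4 L N ε) L N (j + 1) V₀ Us →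
        ∀ CP : ℝ, 0 ≤ CP → SlicePoincare L (j + 1) Us (frameFreeBlockLandauW (d := 4) (n := n) L N (j + 1) Us) CP (periodBox (N * L ^ (j + 1))) →
        28 * (Fintype.card (T4AveragingDeficitWall.Plane 4) : ℝ) * ε * (4 * CP * Fintype.card n) ≤ 1 → ∀ θ : ℝ, 0 < θ →
        ∀ CΛ : ℝ, 0 ≤ CΛ → CΛ * (2 * (4 * CP * Fintype.card n)) ≤ 1 →
        (∀ X : ↥(skewSub 4 n (L * tower L N j)),
          framePotW L (j + 1) Us (chartDir (ContinuousLinearMap.id ℝ (Matrix n n ℂ)) (L * tower L N j) (X : TDir 4 n (L * tower L N j))) = (fun _ => 0) →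
          |fderiv ℝ (fun y : ↥(skewSub 4 n N) => minAct 4 (sfClass 4 L N ε) L N (j + 1) (chart (ContinuousLinearMap.id ℝ (Matrix n n ℂ)) N V₀ (y : TDir 4 n N))) 0
              (fderiv ℝ (fderiv ℝ (strippedConstraint L N j Us)) 0 X X)|
            ≤ ((stepWt 4 L)⁻¹) ^ (j + 1) * (CΛ * (((L : ℝ)⁻¹) ^ (2 * (j + 1))
                * dirSq (chartDir (ContinuousLinearMap.id ℝ (Matrix n n ℂ)) (L * tower L N j) (X : TDir 4 n (L * tower L N j))) (periodBox (tower L N (j + 1)))))) →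
        ∀ v : ↥(skewSub 4 n N),
          (1 - CΛ * (2 * (4 * CP * Fintype.card n)))
              * (((stepWt 4 L)⁻¹) ^ (j + 1) * ∑ P ∈ perWin 4 N, nhsNormSq (curl V₀ (chartDir (ContinuousLinearMap.id ℝ (Matrix n n ℂ)) N (v : TDir 4 n N)) P))
            ≤ ((1 + θ) + 2 * ((1 + θ) * (14 * (Fintype.card (T4AveragingDeficitWall.Plane 4) : ℝ) * ε) + (1 + θ⁻¹) * (36 * eC 4 L (Fintype.card n) ^ 2 * ε ^ 2))
                    * (4 * CP * Fintype.card n))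
                * fderiv ℝ (fderiv ℝ (fun y : ↥(skewSub 4 n N) => minAct 4 (sfClass 4 L N ε) L N (j + 1) (chart (ContinuousLinearMap.id ℝ (Matrix n n ℂ)) N V₀ (y : TDir 4 n N)))) 0 v v
              + ((stepWt 4 L)⁻¹) ^ (j + 1)
                * (2 * (((1 + θ) + 2 * ((1 + θ) * (14 * (Fintype.card (T4AveragingDeficitWall.Plane 4) : ℝ) * ε) + (1 + θ⁻¹) * (36 * eC 4 L (Fintype.card n) ^ 2 * ε ^ 2))
                        * (4 * CP * Fintype.card n))) * CΛ * (2 * liftMassC 4 L + 4 * CP * liftCurlC 4 L)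
                    + (1 - CΛ * (2 * (4 * CP * Fintype.card n)))
                      * (2 * ((1 + θ) * (14 * (Fintype.card (T4AveragingDeficitWall.Plane 4) : ℝ) * ε) + (1 + θ⁻¹) * (36 * eC 4 L (Fintype.card n) ^ 2 * ε ^ 2))
                        * (2 * liftMassC 4 L + 4 * CP * liftCurlC 4 L)))
                * dirSq (chartDir (ContinuousLinearMap.id ℝ (Matrix n n ℂ)) N (v : TDir 4 n N)) (periodBox N) := by
  have hL1 : 1 ≤ L := by omega
  obtain ⟨ε₁, hε₁, T⟩ := bordered_hessian_attained_on_slice_frameFree_uniform (n := n) hL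
  obtain ⟨ε₂, hε₂, S⟩ := multiplier_eq_stripped_allData (n := n) hL
  refine ⟨min ε₁ ε₂, lt_min hε₁ hε₂, fun ε hε hεle hεD2 hεT2 hεM hε1 hcrux hθl2 hEl hα3 hα4 hroom N _ hN => ?_⟩
  obtain ⟨δ₁, hδ₁, T1⟩ := T ε hε (hεle.trans (min_le_left _ _)) hεD2 hεT2 hεM hε1 hcrux hθl2 hEl N hN
  obtain ⟨δ₂, hδ₂, S1⟩ := S ε hε (hεle.trans (min_le_right _ _)) hα3 hα4 hroom N hN
  refine ⟨min δ₁ δ₂, lt_min hδ₁ hδ₂, fun j V₀ hV₀ Us hUs CP hCP hSP habs θ hθ CΛ hCΛ hCΛa hletter v => ?_⟩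
  obtain ⟨hV₀u, hV₀P, hV₀δ⟩ := hV₀
  have hV₀1 : V₀ ∈ {V : Site 4 → Fin 4 → (Matrix n n ℂ)ˣ | IsUnitaryCfg V ∧ IsPeriodicCfg V (N : ℤ) ∧ SmallField V δ₁} :=
    ⟨hV₀u, hV₀P, MinimalActionRate.SmallField.mono hV₀δ (min_le_left _ _)⟩
  have hV₀2 : V₀ ∈ {V : Site 4 → Fin 4 → (Matrix n n ℂ)ˣ | IsUnitaryCfg V ∧ IsPeriodicCfg V (N : ℤ) ∧ SmallField V δ₂} :=
    ⟨hV₀u, hV₀P, MinimalActionRate.SmallField.mono hV₀δ (min_le_right _ _)⟩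
  obtain ⟨Xs, hQ, h1, h2, h3, hff⟩ := T1 j V₀ hV₀1 Us hUs CP hCP hSP habs θ hθ v
  obtain ⟨-, hS2⟩ := S1 j V₀ hV₀2 Us hUs
  have hid := hS2 Xs hff
  have hlet := hletter Xs hff
  -- abbreviations
  set w : ℝ := ((stepWt 4 L)⁻¹) ^ (j + 1) with hw
  set H : ℝ := hess Us (chartDir (ContinuousLinearMap.id ℝ (Matrix n n ℂ)) (L * tower L N j) (Xs : TDir 4 n (L * tower L N j)))
      (chartDir (ContinuousLinearMap.id ℝ (Matrix n n ℂ)) (L * tower L N j) (Xs : TDir 4 n (L * tower L N j))) (perWin 4 (tower L N (j + 1))) with hH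
  set M : ℝ := dirSq (chartDir (ContinuousLinearMap.id ℝ (Matrix n n ℂ)) N (v : TDir 4 n N)) (periodBox N) with hM
  set Q : ℝ := ((L : ℝ)⁻¹) ^ (2 * (j + 1)) * dirSq (chartDir (ContinuousLinearMap.id ℝ (Matrix n n ℂ)) (L * tower L N j) (Xs : TDir 4 n (L * tower L N j))) (periodBox (tower L N (j + 1))) with hQd
  set a : ℝ := 2 * (4 * CP * Fintype.card n) with ha
  set ρ : ℝ := 2 * liftMassC 4 L + 4 * CP * liftCurlC 4 L with hρ
  set K : ℝ := (1 + θ) * (14 * (Fintype.card (T4AveragingDeficitWall.Plane 4) : ℝ) * ε) + (1 + θ⁻¹) * (36 * eC 4 L (Fintype.card n) ^ 2 * ε ^ 2) with hK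
  set A : ℝ := (1 + θ) + 2 * K * (4 * CP * Fintype.card n) with hA
  have hw0 : 0 ≤ w := pow_nonneg (inv_nonneg.mpr (MinimalActionLevels.stepWt_pos (d := 4) L hL1).le) _
  have hK0 : 0 ≤ K := by
    rw [hK]; have := NE7StraightTowerCurlEnergy.eC_nonneg 4 L (ν := (Fintype.card n : ℝ)); positivity
  have hA0 : 0 ≤ A := by rw [hA]; positivity
  have hρ0 : 0 ≤ ρ := by
    rw [hρ]; have := NE7SliceRepHessianFloor.liftMassC_nonneg 4 L; have := NE7SliceRepHessianFloor.liftCurlC_nonneg 4 L; positivity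
  have hM0 : 0 ≤ M := by rw [hM]; unfold dirSq; exact Finset.sum_nonneg fun _ _ => Finset.sum_nonneg fun _ _ => sq_nonneg _
  have h1a : 0 ≤ 1 - CΛ * a := by rw [ha]; linarith
  -- the multiplier term at `Xs` is the stripped one, bounded by the letter and the scaled mass (3)
  have h3' : Q ≤ a * H + 2 * (ρ * M) := by
    have := h3; rw [hQd, ha, hρ, hM, hH]; linarith
  have hΛ : fderiv ℝ (fun y : ↥(skewSub 4 n N) => minAct 4 (sfClass 4 L N ε) L N (j + 1) (chart (ContinuousLinearMap.id ℝ (Matrix n n ℂ)) N V₀ (y : TDir 4 n N))) 0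
        (fderiv ℝ (fderiv ℝ (fun Φ : ↥(skewSub 4 n (L * tower L N j)) =>
          levelQ L N j Us (chart (ContinuousLinearMap.id ℝ (Matrix n n ℂ)) (L * tower L N j) Us (Φ : TDir 4 n (L * tower L N j))))) 0 Xs Xs)
      ≤ w * (CΛ * (a * H + 2 * (ρ * M))) := by
    rw [hid]
    refine (le_abs_self _).trans (hlet.trans ?_)
    exact mul_le_mul_of_nonneg_left (mul_le_mul_of_nonneg_left h3' hCΛ) hw0
  -- (1): `D²m = w·H − Λ`, hence `w(1 − CΛ a)·H ≤ D²m + 2wCΛρM`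
  have hD : w * ((1 - CΛ * a) * H)
      ≤ fderiv ℝ (fderiv ℝ (fun y : ↥(skewSub 4 n N) => minAct 4 (sfClass 4 L N ε) L N (j + 1) (chart (ContinuousLinearMap.id ℝ (Matrix n n ℂ)) N V₀ (y : TDir 4 n N)))) 0 v v
        + w * (2 * CΛ * ρ * M) := by
    rw [h1]
    have e : w * ((1 - CΛ * a) * H) = w * H - w * (CΛ * (a * H + 2 * (ρ * M))) + w * (2 * CΛ * ρ * M) := by ring
    rw [e]
    linarith
  -- (2): the floor, multiplied by `w(1 − CΛ a) ≥ 0`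
  have h2' : ∑ P ∈ perWin 4 N, nhsNormSq (curl V₀ (chartDir (ContinuousLinearMap.id ℝ (Matrix n n ℂ)) N (v : TDir 4 n N)) P) ≤ A * H + 2 * K * (ρ * M) := by
    have := h2; rw [hA, hK, hρ, hM, hH]; linarith
  have hstep : (1 - CΛ * a) * (w * ∑ P ∈ perWin 4 N, nhsNormSq (curl V₀ (chartDir (ContinuousLinearMap.id ℝ (Matrix n n ℂ)) N (v : TDir 4 n N)) P))
      ≤ A * (w * ((1 - CΛ * a) * H)) + w * ((1 - CΛ * a) * (2 * K * (ρ * M))) := by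
    have hh := mul_le_mul_of_nonneg_left h2' (mul_nonneg h1a hw0)
    have e1 : (1 - CΛ * a) * w * (A * H + 2 * K * (ρ * M)) = A * (w * ((1 - CΛ * a) * H)) + w * ((1 - CΛ * a) * (2 * K * (ρ * M))) := by ring
    have e2 : (1 - CΛ * a) * w * ∑ P ∈ perWin 4 N, nhsNormSq (curl V₀ (chartDir (ContinuousLinearMap.id ℝ (Matrix n n ℂ)) N (v : TDir 4 n N)) P)
        = (1 - CΛ * a) * (w * ∑ P ∈ perWin 4 N, nhsNormSq (curl V₀ (chartDir (ContinuousLinearMap.id ℝ (Matrix n n ℂ)) N (v : TDir 4 n N)) P)) := by ring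
    rw [e1, e2] at hh
    exact hh
  have hAD := mul_le_mul_of_nonneg_left hD hA0
  -- assemble
  have e3 : A * (fderiv ℝ (fderiv ℝ (fun y : ↥(skewSub 4 n N) => minAct 4 (sfClass 4 L N ε) L N (j + 1) (chart (ContinuousLinearMap.id ℝ (Matrix n n ℂ)) N V₀ (y : TDir 4 n N)))) 0 v v
        + w * (2 * CΛ * ρ * M)) + w * ((1 - CΛ * a) * (2 * K * (ρ * M)))
      = A * fderiv ℝ (fderiv ℝ (fun y : ↥(skewSub 4 n N) => minAct 4 (sfClass 4 L N ε) L N (j + 1) (chart (ContinuousLinearMap.id ℝ (Matrix n n ℂ)) N V₀ (y : TDir 4 n N)))) 0 v v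
        + w * (2 * A * CΛ * ρ + (1 - CΛ * a) * (2 * K * ρ)) * M := by ring
  calc (1 - CΛ * a) * (w * ∑ P ∈ perWin 4 N, nhsNormSq (curl V₀ (chartDir (ContinuousLinearMap.id ℝ (Matrix n n ℂ)) N (v : TDir 4 n N)) P))
      ≤ A * (w * ((1 - CΛ * a) * H)) + w * ((1 - CΛ * a) * (2 * K * (ρ * M))) := hstep
    _ ≤ A * (fderiv ℝ (fderiv ℝ (fun y : ↥(skewSub 4 n N) => minAct 4 (sfClass 4 L N ε) L N (j + 1) (chart (ContinuousLinearMap.id ℝ (Matrix n n ℂ)) N V₀ (y : TDir 4 n N)))) 0 v v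
          + w * (2 * CΛ * ρ * M)) + w * ((1 - CΛ * a) * (2 * K * (ρ * M))) := by linarith
    _ = _ := by rw [e3]

end

end Summit.QuantumFields.BalabanUV.T4Continuum.NE7EffectiveFormLowerBoundSocketUniform
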